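import Summits.BirchSwinnertonDyer.BirchSwinnertonDyer.Theorems.GenusKolyvaginAtTwoPowDvdShaCardAtTwoRTKummerExactReal
import Summits.BirchSwinnertonDyer.BirchSwinnertonDyer.Theorems.GenusKolyvaginAtTwoPowDvdShaCardAtTwoRTAuxiliaryClass
import Summits.BirchSwinnertonDyer.BirchSwinnertonDyer.Theorems.SchneiderFreeAdditiveX3PoitouTateSelmerComplementCanonical
import Summits.BirchSwinnertonDyer.BirchSwinnertonDyer.Theorems.SchneiderFreeAdditiveX3PoitouTateReciprocitySumHolds
import HarnessLib

/-!
# Route `GenusKolyvaginAtTwo`, LINES 18/19 (L_T stmt-BirchSwinnertonDyer-23242, L⁺_T stmt-23379), step (b) input I5 over `ℚ`: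
# McCALLUM 1991 PROP. 2.1 OVER ANY NUMBER FIELD (REAL PLACES ALLOWED, e.g. `K = ℚ`) — UNCONDITIONAL for the canonical family

Width seat `bsd-line-gk2-p4` g16 (cell `bsd-f1-sign2`), `--supports stmt-BirchSwinnertonDyer-23242` (helper; closes nothing). THEOREMS ONLY
(no definition, no named fact, no `sorry`; standard axioms). Sequel of `…RTKummerExactReal.lean` and `…RTAuxiliaryClass{Count,}.lean`.

WHAT (namespace `…Theorems.GenusExact.AuxiliaryClass`; `W` elliptic over ANY number field `K`, level `p^k`, `S`, `w` finite places):
* `annLeft_map_kummerOutside_eq_real`, `natCard_map_kummerOutside_sq_real` — McCallum's maximal-isotropic count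
  `#loc_T(H¹_{𝓛, ⊤ on T})² = ∏_{v∈T} #H¹(K_v, E[p^k])` for families injective at the real places (proofs verbatim from part 1).
* **`exists_ne_zero_mem_kummerOutside_real`** = Prop. 2.1 over the displayed inputs + `hreal`.
* **`exists_ne_zero_selmerLocalKer_real` / `_real_of_torsion` — UNCONDITIONAL over ANY number field** via THE canonical family
  `LocalInvariants.canonical K (p^k)` (`canonical_isPerfect`, `sumLocalTermEqZero_canonical`, `selmerComplement_canonical_holds`,
  `archimedeanInvariantMap_injective_of_isReal`) and Tate's count (`localEulerPoincareCharacteristic_holds`): for `k ≥ 1`, `S`,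
  `w ∉ S` with `1 < #H¹(K_w, E[p^k])` (resp. `1 < #E(K_w)[p^k]`) and half-length `H_v` (`v ∈ S`) there is `c ≠ 0` in `H¹(K, E[p^k])`
  with `loc_v c ∈ H_v` on `S` and `c ∈ selmerLocalKer` at every other finite place except `w` AND AT EVERY INFINITE PLACE.
* `mcCallum_prop_2_1_primePow_real` — the body of the named fact `McCallum1991_prop_2_1_auxiliaryClass K` at `m = p^k` for ANY
  number field `K`, with `w` and the members of `S` FINITE places (as `Place`s): `loc_v c ∈ 𝓛_v` for all places `v ∉ S`, `v ≠ w`.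

NOT here: members of `S` at real places; composite `m`.  BSD is NOT proved by any of this.
References: [McCallumLMS1991] §2 Prop. 2.1; [MilneADT2006] Ch. I Cor. 2.3, Thm. 2.8, 2.13, 4.10(b), Ex. 1.6(c); [Howard2004HeegnerKolyvagin] Thm. 2.1.11.
-/

set_option autoImplicit false
-- the Theorems namespace of this sub repeats the summit name by design (D-0017 nested layout)
set_option linter.dupNamespace false

noncomputable section

open scoped Classical

open CategoryTheory Field NumberField IsDedekindDomain Function
open Literature.NumberTheory.EllipticCurves
open Literature.NumberTheory.GaloisRepresentations
open Literature.NumberTheory.GaloisRepresentations.DiscreteGaloisModule (SelmerStructure)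
open Literature.NumberTheory.GaloisCohomology
open Summit.BirchSwinnertonDyer.Rank1Residual.X11b.KummerPT
open Summit.BirchSwinnertonDyer.Rank1Residual.X11b.FiniteDuality
open Summit.BirchSwinnertonDyer.Rank1Residual.X11b.Relaxation
open Summit.BirchSwinnertonDyer.Rank1Residual.X11b.LocBridge Summit.BirchSwinnertonDyer.Rank1Residual.X11b.Levels
open Summit.BirchSwinnertonDyer.Rank1Residual.X11b.AcSelmer
open scoped ContRepresentation

namespace Summit.BirchSwinnertonDyer.BirchSwinnertonDyer.Theorems.GenusExact.AuxiliaryClass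

section Kummer

variable {K : Type} [Field K] [NumberField K] (W : WeierstrassCurve K) [W.IsElliptic] (p k : ℕ)
  [Fact p.Prime] [Finite (W.geomTorsion ((p ^ k : ℕ) : ℤ))]

variable (e : W.geomTorsion ((p ^ k : ℕ) : ℤ) → W.geomTorsion ((p ^ k : ℕ) : ℤ) → AlgebraicClosure K)
  (hμ : ∀ S T, e S T ^ (p ^ k) = 1)
  (hadd₁ : ∀ S₁ S₂ T, e (S₁ + S₂) T = e S₁ T * e S₂ T)
  (hadd₂ : ∀ S T₁ T₂, e S (T₁ + T₂) = e S T₁ * e S T₂)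
  (hgal : ∀ (σ : absoluteGaloisGroup K) (S T : W.geomTorsion ((p ^ k : ℕ) : ℤ)),
    σ • e S T = e (σ • S) (σ • T))
  (halt : ∀ T, e T T = 1) (hnondeg : ∀ T, (∀ S, e S T = 1) → T = 0)

include halt hnondeg in
/-- **`G = loc_T(H¹_{𝓛, ⊤ on T}(K, E[p^k]))` is its own (left) annihilator** under the sum pairing, over any number field,
for families injective at the real places (proof verbatim from part 1's `annLeft_map_kummerOutside_eq`, with the exactness theorem
`exists_mem_kummerOutside_localization_eq_real`). [cite: McCallumLMS1991, §2 proof of Prop. 2.1] [cite: MilneADT2006, Ch. I, Thm. 4.10(b)] -/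
theorem annLeft_map_kummerOutside_eq_real {inv : LocalInvariants K (p ^ k)} (hperf : inv.IsPerfect) (hsum : inv.SumLocalTermEqZero)
    (hcompl : inv.SelmerComplement)
    (hEuler : ∀ v : HeightOneSpectrum (𝓞 K),
      Nat.card (galoisCohomology ((W.torsionGaloisModule ((p ^ k : ℕ) : ℤ)).toLocal (Sum.inr v)) 1) =
        (Nat.card (nsmulAddMonoidHom (p ^ k) :
            (W.baseChange (v.adicCompletion K)).toAffine.Point →+ _).ker *
          Nat.card (v.adicCompletionIntegers K ⧸
            Ideal.span {((p ^ k : ℕ) : v.adicCompletionIntegers K)})) ^ 2)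
    (hreal : ∀ w : InfinitePlace K, w.IsReal → Injective (inv (Sum.inl w)))
    (T : Finset (HeightOneSpectrum (𝓞 K)))
    (loc : galoisCohomology (W.torsionGaloisModule ((p ^ k : ℕ) : ℤ)) 1 →+
      (∀ u : ↥T, galoisCohomology ((W.torsionGaloisModule ((p ^ k : ℕ) : ℤ)).toLocal
        (Sum.inr (u : HeightOneSpectrum (𝓞 K)))) 1))
    (hloc : ∀ c u, loc c u = galoisCohomology.localization (W.torsionGaloisModule ((p ^ k : ℕ) : ℤ))
      (Sum.inr (u : HeightOneSpectrum (𝓞 K))) 1 c)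
    (bP : (∀ u : ↥T, galoisCohomology ((W.torsionGaloisModule ((p ^ k : ℕ) : ℤ)).toLocal
            (Sum.inr (u : HeightOneSpectrum (𝓞 K)))) 1) →+
          (∀ u : ↥T, galoisCohomology ((W.torsionGaloisModule ((p ^ k : ℕ) : ℤ)).toLocal
            (Sum.inr (u : HeightOneSpectrum (𝓞 K)))) 1) →+ ZMod (p ^ k))
    (hbP : ∀ x y, bP x y = ∑ u : ↥T, invWeilPairing W (p ^ k) e hμ hadd₁ hadd₂ hgal inv
      (Sum.inr (u : HeightOneSpectrum (𝓞 K))) (x u) (y u)) :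
    annLeft bP ((kummerOutside W (p ^ k) (T.map Function.Embedding.inr)).map loc) =
      (kummerOutside W (p ^ k) (T.map Function.Embedding.inr)).map loc := by
  classical
  have hsumT : ∀ F : Place K → ZMod (p ^ k),
      ∑ u : ↥T, F (Sum.inr (u : HeightOneSpectrum (𝓞 K))) = ∑ v ∈ T.map Function.Embedding.inr, F v :=
    fun F ↦ sum_coe_eq_sum_map_inr T F
  ext t
  constructor
  · intro ht
    rw [mem_annLeft_iff] at ht
    -- the test family, extended by zero to all places
    obtain ⟨tfull, htfull⟩ := exists_extend_by_zero
      (X := fun v : Place K ↦ galoisCohomology ((W.torsionGaloisModule ((p ^ k : ℕ) : ℤ)).toLocal v) 1) T t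
    obtain ⟨x, hx, hxt⟩ := exists_mem_kummerOutside_localization_eq_real W p k e hμ hadd₁ hadd₂ hgal halt hnondeg
      hperf hcompl hEuler hreal (T.map Function.Embedding.inr) tfull (fun c hc ↦ by
        have h := ht (loc c) ⟨c, hc, rfl⟩
        rw [hbP] at h
        rw [← hsumT]
        refine Eq.trans (Finset.sum_congr rfl fun u _ ↦ ?_) h
        rw [htfull, hloc])
    refine ⟨x, hx, ?_⟩
    funext u
    rw [hloc, hxt _ (by rw [Finset.mem_map]; exact ⟨u, u.2, rfl⟩), htfull]
  · rintro ⟨c, hc, rfl⟩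
    rw [mem_annLeft_iff]
    rintro g ⟨c', hc', rfl⟩
    rw [hbP]
    have h := sum_invWeilPairing_localization_eq_zero_of_mem_kummerOutside W (p ^ k) e hμ hadd₁ hadd₂ hgal halt
      inv hsum (T.map Function.Embedding.inr) hc hc'
    rw [← hsumT] at h
    refine Eq.trans (Finset.sum_congr rfl fun u _ ↦ ?_) h
    rw [hloc, hloc]

include e hμ hadd₁ hadd₂ hgal halt hnondeg in
/-- **McCallum's «maximal isotropic» count over any number field**: `#loc_T(H¹_{𝓛, ⊤ on T})² = ∏_{v∈T} #H¹(K_v, E[p^k])`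
(proof verbatim from part 1's `natCard_map_kummerOutside_sq`). [cite: McCallumLMS1991, §2 proof of Prop. 2.1] -/
theorem natCard_map_kummerOutside_sq_real {inv : LocalInvariants K (p ^ k)} (hperf : inv.IsPerfect) (hsum : inv.SumLocalTermEqZero)
    (hcompl : inv.SelmerComplement)
    (hEuler : ∀ v : HeightOneSpectrum (𝓞 K),
      Nat.card (galoisCohomology ((W.torsionGaloisModule ((p ^ k : ℕ) : ℤ)).toLocal (Sum.inr v)) 1) =
        (Nat.card (nsmulAddMonoidHom (p ^ k) :
            (W.baseChange (v.adicCompletion K)).toAffine.Point →+ _).ker *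
          Nat.card (v.adicCompletionIntegers K ⧸
            Ideal.span {((p ^ k : ℕ) : v.adicCompletionIntegers K)})) ^ 2)
    (hreal : ∀ w : InfinitePlace K, w.IsReal → Injective (inv (Sum.inl w)))
    (T : Finset (HeightOneSpectrum (𝓞 K)))
    (loc : galoisCohomology (W.torsionGaloisModule ((p ^ k : ℕ) : ℤ)) 1 →+
      (∀ u : ↥T, galoisCohomology ((W.torsionGaloisModule ((p ^ k : ℕ) : ℤ)).toLocal
        (Sum.inr (u : HeightOneSpectrum (𝓞 K)))) 1))
    (hloc : ∀ c u, loc c u = galoisCohomology.localization (W.torsionGaloisModule ((p ^ k : ℕ) : ℤ))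
      (Sum.inr (u : HeightOneSpectrum (𝓞 K))) 1 c) :
    Nat.card ((kummerOutside W (p ^ k) (T.map Function.Embedding.inr)).map loc) ^ 2 =
      ∏ v ∈ T, Nat.card (galoisCohomology ((W.torsionGaloisModule ((p ^ k : ℕ) : ℤ)).toLocal (Sum.inr v)) 1) := by
  classical
  haveI hfin : ∀ u : ↥T, Finite (galoisCohomology ((W.torsionGaloisModule ((p ^ k : ℕ) : ℤ)).toLocal
      (Sum.inr (u : HeightOneSpectrum (𝓞 K)))) 1) :=
    fun u ↦ finite_galoisCohomology_toLocal_inr W (p ^ k) u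
  have hA : ∀ (u : ↥T) (x : galoisCohomology ((W.torsionGaloisModule ((p ^ k : ℕ) : ℤ)).toLocal
      (Sum.inr (u : HeightOneSpectrum (𝓞 K)))) 1), (p ^ k) • x = 0 :=
    fun u x ↦ nsmul_galoisCohomology_toLocal_eq_zero W (p ^ k) _ x
  obtain ⟨bP, hbP⟩ := exists_piSum (fun u : ↥T ↦ invWeilPairing W (p ^ k) e hμ hadd₁ hadd₂ hgal inv
    (Sum.inr (u : HeightOneSpectrum (𝓞 K))))
  have hbij : Bijective bP := bijective_piSum hA _
    (fun u ↦ (invWeilPairing_bijective W (p ^ k) e hμ hadd₁ hadd₂ hgal hnondeg inv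
      (u : HeightOneSpectrum (𝓞 K)) (hperf u).1.1).1) bP hbP
  haveI : Finite (∀ u : ↥T, galoisCohomology ((W.torsionGaloisModule ((p ^ k : ℕ) : ℤ)).toLocal
      (Sum.inr (u : HeightOneSpectrum (𝓞 K)))) 1) := Pi.finite
  have hA' : ∀ x : (∀ u : ↥T, galoisCohomology ((W.torsionGaloisModule ((p ^ k : ℕ) : ℤ)).toLocal
      (Sum.inr (u : HeightOneSpectrum (𝓞 K)))) 1), (p ^ k) • x = 0 :=
    fun x ↦ funext fun u ↦ by rw [Pi.smul_apply, Pi.zero_apply, hA u (x u)]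
  have hcount := natCard_annLeft_mul hA' bP hbij ((kummerOutside W (p ^ k) (T.map Function.Embedding.inr)).map loc)
  rw [annLeft_map_kummerOutside_eq_real W p k e hμ hadd₁ hadd₂ hgal halt hnondeg hperf hsum hcompl hEuler hreal T loc
    hloc bP hbP] at hcount
  rw [sq, hcount, Nat.card_pi, Finset.prod_coe_sort T fun v ↦
    Nat.card (galoisCohomology ((W.torsionGaloisModule ((p ^ k : ℕ) : ℤ)).toLocal (Sum.inr v)) 1)]


include e hμ hadd₁ hadd₂ hgal halt hnondeg in
/-- **McCallum 1991, Proposition 2.1 over ANY number field** (displayed analytic inputs + `hreal`): `S` finite places, `w ∉ S`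
with `1 < #H¹(K_w, E[p^k])`, half-length `H_v` (`v ∈ S`) ⟹ `∃ c ∈ kummerOutside W (p^k) (S ∪ {w}), c ≠ 0 ∧ ∀ v ∈ S, loc_v c ∈ H_v`
(McCallum's pigeonhole, verbatim from part 2's `exists_ne_zero_mem_kummerOutside`). [cite: McCallumLMS1991, §2 Prop. 2.1] -/
theorem exists_ne_zero_mem_kummerOutside_real {inv : LocalInvariants K (p ^ k)} (hperf : inv.IsPerfect) (hsum : inv.SumLocalTermEqZero)
    (hcompl : inv.SelmerComplement)
    (hEuler : ∀ v : HeightOneSpectrum (𝓞 K),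
      Nat.card (galoisCohomology ((W.torsionGaloisModule ((p ^ k : ℕ) : ℤ)).toLocal (Sum.inr v)) 1) =
        (Nat.card (nsmulAddMonoidHom (p ^ k) :
            (W.baseChange (v.adicCompletion K)).toAffine.Point →+ _).ker *
          Nat.card (v.adicCompletionIntegers K ⧸
            Ideal.span {((p ^ k : ℕ) : v.adicCompletionIntegers K)})) ^ 2)
    (hreal : ∀ w : InfinitePlace K, w.IsReal → Injective (inv (Sum.inl w)))
    (S : Finset (HeightOneSpectrum (𝓞 K))) (w : HeightOneSpectrum (𝓞 K)) (hwS : w ∉ S)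
    (hw : 1 < Nat.card (galoisCohomology ((W.torsionGaloisModule ((p ^ k : ℕ) : ℤ)).toLocal (Sum.inr w)) 1))
    (H : ∀ v : HeightOneSpectrum (𝓞 K),
      AddSubgroup (galoisCohomology ((W.torsionGaloisModule ((p ^ k : ℕ) : ℤ)).toLocal (Sum.inr v)) 1))
    (hH : ∀ v ∈ S, Nat.card (H v) ^ 2 =
      Nat.card (galoisCohomology ((W.torsionGaloisModule ((p ^ k : ℕ) : ℤ)).toLocal (Sum.inr v)) 1)) :
    ∃ c ∈ kummerOutside W (p ^ k) ((insert w S).map Function.Embedding.inr), c ≠ 0 ∧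
      ∀ v ∈ S, galoisCohomology.localization (W.torsionGaloisModule ((p ^ k : ℕ) : ℤ)) (Sum.inr v) 1 c ∈ H v := by
  classical
  -- the product localisation over `T = S ∪ {w}` and the image `G`
  obtain ⟨loc, hloc⟩ : ∃ loc : galoisCohomology (W.torsionGaloisModule ((p ^ k : ℕ) : ℤ)) 1 →+
      (∀ u : ↥(insert w S), galoisCohomology ((W.torsionGaloisModule ((p ^ k : ℕ) : ℤ)).toLocal
        (Sum.inr (u : HeightOneSpectrum (𝓞 K)))) 1),
      ∀ c u, loc c u = galoisCohomology.localization (W.torsionGaloisModule ((p ^ k : ℕ) : ℤ))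
        (Sum.inr (u : HeightOneSpectrum (𝓞 K))) 1 c :=
    ⟨AddMonoidHom.pi fun u ↦ galoisCohomology.localization (W.torsionGaloisModule ((p ^ k : ℕ) : ℤ))
      (Sum.inr (u : HeightOneSpectrum (𝓞 K))) 1, fun c u ↦ rfl⟩
  obtain ⟨G, hG⟩ : ∃ G : AddSubgroup (∀ u : ↥(insert w S), galoisCohomology
      ((W.torsionGaloisModule ((p ^ k : ℕ) : ℤ)).toLocal (Sum.inr (u : HeightOneSpectrum (𝓞 K)))) 1),
      G = (kummerOutside W (p ^ k) ((insert w S).map Function.Embedding.inr)).map loc := ⟨_, rfl⟩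
  haveI hfin : ∀ u : HeightOneSpectrum (𝓞 K), Finite (galoisCohomology
      ((W.torsionGaloisModule ((p ^ k : ℕ) : ℤ)).toLocal (Sum.inr u)) 1) :=
    fun u ↦ finite_galoisCohomology_toLocal_inr W (p ^ k) u
  haveI : Finite (∀ u : ↥(insert w S), galoisCohomology ((W.torsionGaloisModule ((p ^ k : ℕ) : ℤ)).toLocal
      (Sum.inr (u : HeightOneSpectrum (𝓞 K)))) 1) := Pi.finite
  -- the count `#G² = #H¹(K_w) · ∏_{v∈S} #H¹(K_v)`
  have hGsq : Nat.card G ^ 2 =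
      Nat.card (galoisCohomology ((W.torsionGaloisModule ((p ^ k : ℕ) : ℤ)).toLocal (Sum.inr w)) 1) *
        ∏ v ∈ S, Nat.card (galoisCohomology ((W.torsionGaloisModule ((p ^ k : ℕ) : ℤ)).toLocal (Sum.inr v)) 1) := by
    rw [hG, natCard_map_kummerOutside_sq_real W p k e hμ hadd₁ hadd₂ hgal halt hnondeg hperf hsum hcompl hEuler hreal
      (insert w S) loc hloc, Finset.prod_insert hwS]
  -- local sizes: `#(H¹(K_v)/H_v) = #H_v`
  have hq : ∀ v ∈ S, Nat.card (galoisCohomology ((W.torsionGaloisModule ((p ^ k : ℕ) : ℤ)).toLocal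
      (Sum.inr v)) 1 ⧸ H v) = Nat.card (H v) := by
    intro v hv
    have h1 := AddSubgroup.card_eq_card_quotient_mul_card_addSubgroup (H v)
    have h2 := hH v hv
    have hpos : 0 < Nat.card (H v) := Nat.card_pos
    apply Nat.eq_of_mul_eq_mul_right hpos
    rw [← h1, ← h2, sq]
  -- the projection `Π_{u∈T} H¹(K_u) → Π_{v∈S} H¹(K_v)/H_v`
  obtain ⟨π, hπ⟩ : ∃ π : (∀ u : ↥(insert w S), galoisCohomology ((W.torsionGaloisModule ((p ^ k : ℕ) : ℤ)).toLocal
      (Sum.inr (u : HeightOneSpectrum (𝓞 K)))) 1) →+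
      (∀ v : ↥S, galoisCohomology ((W.torsionGaloisModule ((p ^ k : ℕ) : ℤ)).toLocal
        (Sum.inr (v : HeightOneSpectrum (𝓞 K)))) 1 ⧸ H v),
      ∀ x v, π x v = QuotientAddGroup.mk (x ⟨v, Finset.mem_insert_of_mem v.2⟩) :=
    ⟨AddMonoidHom.pi fun v : ↥S ↦ (QuotientAddGroup.mk' (H v)).comp
      (Pi.evalAddMonoidHom (fun u : ↥(insert w S) ↦ galoisCohomology
        ((W.torsionGaloisModule ((p ^ k : ℕ) : ℤ)).toLocal (Sum.inr (u : HeightOneSpectrum (𝓞 K)))) 1)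
        ⟨v, Finset.mem_insert_of_mem v.2⟩), fun x v ↦ rfl⟩
  -- `π|_G` is not injective, by counting
  have hnotinj : ¬ Injective (π.comp G.subtype) := by
    intro hinj
    haveI : Finite (∀ v : ↥S, galoisCohomology ((W.torsionGaloisModule ((p ^ k : ℕ) : ℤ)).toLocal
        (Sum.inr (v : HeightOneSpectrum (𝓞 K)))) 1 ⧸ H v) := Pi.finite
    have hle : Nat.card G ≤ ∏ v ∈ S, Nat.card (H v) := by
      have h := Nat.card_le_card_of_injective _ hinj
      rw [Nat.card_pi, Finset.prod_coe_sort S fun v ↦ Nat.card (galoisCohomology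
        ((W.torsionGaloisModule ((p ^ k : ℕ) : ℤ)).toLocal (Sum.inr v)) 1 ⧸ H v)] at h
      exact h.trans (Finset.prod_congr rfl hq).le
    have hprod : ∏ v ∈ S, Nat.card (galoisCohomology ((W.torsionGaloisModule ((p ^ k : ℕ) : ℤ)).toLocal
        (Sum.inr v)) 1) = (∏ v ∈ S, Nat.card (H v)) ^ 2 := by
      rw [← Finset.prod_pow]
      exact Finset.prod_congr rfl fun v hv ↦ (hH v hv).symm
    have hXpos : 0 < (∏ v ∈ S, Nat.card (H v)) ^ 2 :=
      pow_pos (Finset.prod_pos fun v _ ↦ (Nat.card_pos (α := H v))) 2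
    have h1 : Nat.card G ^ 2 ≤ (∏ v ∈ S, Nat.card (H v)) ^ 2 := Nat.pow_le_pow_left hle 2
    rw [hGsq, hprod] at h1
    have h3 := Nat.mul_le_mul_right ((∏ v ∈ S, Nat.card (H v)) ^ 2) hw
    omega
  -- a non-zero kernel element of `π|_G`
  rw [injective_iff_map_eq_zero] at hnotinj
  push Not at hnotinj
  obtain ⟨⟨g, hgG⟩, hg0, hgne⟩ := hnotinj
  rw [hG] at hgG
  obtain ⟨c, hc, hcg⟩ := hgG
  refine ⟨c, hc, ?_, fun v hv ↦ ?_⟩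
  · rintro rfl
    apply hgne
    apply Subtype.ext
    change g = 0
    rw [← hcg, map_zero]
  · have h := congr_fun hg0 ⟨v, hv⟩
    change π g ⟨v, hv⟩ = 0 at h
    rw [hπ, QuotientAddGroup.eq_zero_iff, ← hcg, hloc] at h
    exact h


/-! ## Unconditional over any number field: the canonical family -/
omit [Finite (W.geomTorsion ((p ^ k : ℕ) : ℤ))] in
/-- **McCallum's Prop. 2.1 over ANY number field — UNCONDITIONAL**, in `selmerLocalKer` currency: for `E = W` elliptic over a number
field `K` (real places allowed, e.g. `K = ℚ`), `k ≥ 1`, a finite set `S` of finite places, a finite place `w ∉ S` with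
`1 < #H¹(K_w, E[p^k])`, and `H_v ≤ H¹(K_v, E[p^k])` with `#H_v² = #H¹(K_v, E[p^k])` (`v ∈ S`): there is `c : galH1Torsion W (p^k)`,
`c ≠ 0`, `loc_v c ∈ H_v` on `S`, `c ∈ selmerLocalKer W K_v (p^k)` at every finite `v ∉ S ∪ {w}` and at EVERY infinite place.
Inputs: THE canonical family of local invariant maps (`canonical_isPerfect`, `sumLocalTermEqZero_canonical`,
`selmerComplement_canonical_holds`, injective at the real places by `archimedeanInvariantMap_injective_of_isReal`), Tate's count
(`localEulerPoincareCharacteristic_holds`), the Weil pairing (`exists_weilPairing_holds`) — all tree theorems.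
[cite: McCallumLMS1991, §2 Prop. 2.1] [cite: MilneADT2006, Ch. I, Thm. 2.8, Thm. 4.10(b) and Ex. 1.6(c)] -/
theorem exists_ne_zero_selmerLocalKer_real (hk : 0 < k)
    (S : Finset (HeightOneSpectrum (𝓞 K))) (w : HeightOneSpectrum (𝓞 K)) (hwS : w ∉ S)
    (hw : 1 < Nat.card (galoisCohomology ((W.torsionGaloisModule ((p ^ k : ℕ) : ℤ)).toLocal (Sum.inr w)) 1))
    (H : ∀ v : HeightOneSpectrum (𝓞 K),
      AddSubgroup (galoisCohomology ((W.torsionGaloisModule ((p ^ k : ℕ) : ℤ)).toLocal (Sum.inr v)) 1))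
    (hH : ∀ v ∈ S, Nat.card (H v) ^ 2 =
      Nat.card (galoisCohomology ((W.torsionGaloisModule ((p ^ k : ℕ) : ℤ)).toLocal (Sum.inr v)) 1)) :
    ∃ c : W.galH1Torsion ((p ^ k : ℕ) : ℤ), c ≠ 0 ∧
      (∀ v ∈ S, galoisCohomology.localization (W.torsionGaloisModule ((p ^ k : ℕ) : ℤ)) (Sum.inr v) 1 c ∈ H v) ∧
      (∀ v : HeightOneSpectrum (𝓞 K), v ∉ S → v ≠ w →
        c ∈ W.selmerLocalKer (v.adicCompletion K) ((p ^ k : ℕ) : ℤ)) ∧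
      (∀ w' : InfinitePlace K, c ∈ W.selmerLocalKer w'.Completion ((p ^ k : ℕ) : ℤ)) := by
  have hprime : p.Prime := Fact.out
  have hpp : IsPrimePow (p ^ k) := ⟨p, k, hprime.prime, hk, rfl⟩
  have hp2 : 2 ≤ p ^ k := le_trans hprime.two_le (Nat.le_self_pow hk.ne' p)
  have hchar : ((p ^ k : ℕ) : K) ≠ 0 := Nat.cast_ne_zero.mpr (pow_ne_zero _ hprime.ne_zero)
  haveI : Finite (W.geomTorsion ((p ^ k : ℕ) : ℤ)) := finite_geomTorsion_pow W p k
  obtain ⟨e, hμ, hadd₁, hadd₂, halt, hnondeg, hgal⟩ := W.exists_weilPairing_holds (p ^ k) hp2 hchar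
  have hperf := LocalInvariants.canonical_isPerfect (K := K) (n := p ^ k)
  have hsum := Summit.BirchSwinnertonDyer.BirchSwinnertonDyer.Theorems.SchneiderFreeAdditiveX3.PoitouTateReduction.sumLocalTermEqZero_canonical
    (K := K) (p ^ k)
  have hcompl := Summit.BirchSwinnertonDyer.BirchSwinnertonDyer.Theorems.SchneiderFreeAdditiveX3.PoitouTateReduction.selmerComplement_canonical_holds
    K (p ^ k)
  have hreal : ∀ w' : InfinitePlace K, w'.IsReal →
      Injective (LocalInvariants.canonical K (p ^ k) (Sum.inl w')) := fun w' hw' ↦ by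
    rw [LocalInvariants.canonical_inl]
    exact archimedeanInvariantMap_injective_of_isReal hw'
  have hEuler : ∀ v : HeightOneSpectrum (𝓞 K),
      Nat.card (galoisCohomology ((W.torsionGaloisModule ((p ^ k : ℕ) : ℤ)).toLocal (Sum.inr v)) 1) =
        (Nat.card (nsmulAddMonoidHom (p ^ k) :
            (W.baseChange (v.adicCompletion K)).toAffine.Point →+ _).ker *
          Nat.card (v.adicCompletionIntegers K ⧸
            Ideal.span {((p ^ k : ℕ) : v.adicCompletionIntegers K)})) ^ 2 := fun v ↦ by
    haveI : CharZero (v.adicCompletion K) := charZero_adicCompletion v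
    exact natCard_galoisCohomology_one_torsion_adicCompletion_eq_sq W v (p ^ k) hpp
      (localEulerPoincareCharacteristic_holds (v.adicCompletion K))
  obtain ⟨c, hc, hc0, hcH⟩ := exists_ne_zero_mem_kummerOutside_real W p k e hμ hadd₁ hadd₂ hgal halt hnondeg hperf hsum
    hcompl hEuler hreal S w hwS hw H hH
  have hc' := (mem_kummerOutside_iff W (p ^ k) _ c).mp hc
  have key : ∀ v : Place K, v ∉ (insert w S).map Function.Embedding.inr →
      c ∈ W.selmerLocalKer (Place.Completion v) ((p ^ k : ℕ) : ℤ) := by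
    intro v hv
    rw [← W.comap_localization_kummerSelmerStructure ((p ^ k : ℕ) : ℤ) v]
    exact hc' v hv
  refine ⟨c, hc0, hcH, fun v hvS hvw ↦ ?_, fun w' ↦ ?_⟩
  · rw [← W.selmerLocalKer_completion_inr]
    refine key (Sum.inr v) fun h ↦ ?_
    rw [Finset.mem_map] at h
    obtain ⟨u, hu, huv⟩ := h
    have huv' : u = v := Sum.inr_injective huv
    subst huv'
    rcases Finset.mem_insert.mp hu with h | h
    · exact hvw h
    · exact hvS h
  · rw [← W.selmerLocalKer_completion_inl]
    refine key (Sum.inl w') fun h ↦ ?_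
    rw [Finset.mem_map] at h
    obtain ⟨u, -, huv⟩ := h
    exact Sum.inr_ne_inl huv

omit [Finite (W.geomTorsion ((p ^ k : ℕ) : ℤ))] in
/-- **The same with the hypothesis at `w` in McCallum's printed form `E(K_w)[p^k] ≠ 0`** (`1 < #E(K_w)[p^k]`), any number field.
[cite: McCallumLMS1991, §2 Prop. 2.1] [cite: MilneADT2006, Ch. I, Thm. 2.8] -/
theorem exists_ne_zero_selmerLocalKer_real_of_torsion (hk : 0 < k)
    (S : Finset (HeightOneSpectrum (𝓞 K))) (w : HeightOneSpectrum (𝓞 K)) (hwS : w ∉ S)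
    (htor : 1 < Nat.card (nsmulAddMonoidHom (p ^ k) :
        (W.baseChange (w.adicCompletion K)).toAffine.Point →+ _).ker)
    (H : ∀ v : HeightOneSpectrum (𝓞 K),
      AddSubgroup (galoisCohomology ((W.torsionGaloisModule ((p ^ k : ℕ) : ℤ)).toLocal (Sum.inr v)) 1))
    (hH : ∀ v ∈ S, Nat.card (H v) ^ 2 =
      Nat.card (galoisCohomology ((W.torsionGaloisModule ((p ^ k : ℕ) : ℤ)).toLocal (Sum.inr v)) 1)) :
    ∃ c : W.galH1Torsion ((p ^ k : ℕ) : ℤ), c ≠ 0 ∧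
      (∀ v ∈ S, galoisCohomology.localization (W.torsionGaloisModule ((p ^ k : ℕ) : ℤ)) (Sum.inr v) 1 c ∈ H v) ∧
      (∀ v : HeightOneSpectrum (𝓞 K), v ∉ S → v ≠ w →
        c ∈ W.selmerLocalKer (v.adicCompletion K) ((p ^ k : ℕ) : ℤ)) ∧
      (∀ w' : InfinitePlace K, c ∈ W.selmerLocalKer w'.Completion ((p ^ k : ℕ) : ℤ)) := by
  have hprime : p.Prime := Fact.out
  have hpp : IsPrimePow (p ^ k) := ⟨p, k, hprime.prime, hk, rfl⟩
  haveI : CharZero (w.adicCompletion K) := charZero_adicCompletion w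
  have hEuler := natCard_galoisCohomology_one_torsion_adicCompletion_eq_sq W w (p ^ k) hpp
    (localEulerPoincareCharacteristic_holds (w.adicCompletion K))
  exact exists_ne_zero_selmerLocalKer_real W p k hk S w hwS
    (one_lt_natCard_localH1_of_torsion W p k w hEuler htor) H hH

omit [Finite (W.geomTorsion ((p ^ k : ℕ) : ℤ))] in
/-- **The named fact `McCallum1991_prop_2_1_auxiliaryClass K` at `m = p^k`, for ANY number field `K`, when `w` and the
members of `S` are FINITE places** (as `Place`s; the conclusion in the fact's currency: `loc_v c ∈ W.kummerSelmerStructure (p^k) v`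
for every place `v ∉ S`, `v ≠ w`, finite or infinite). [cite: McCallumLMS1991, §2 Prop. 2.1] -/
theorem mcCallum_prop_2_1_primePow_real (hk : 0 < k) (w : HeightOneSpectrum (𝓞 K))
    (hw : ∃ x : galoisCohomology ((W.torsionGaloisModule ((p ^ k : ℕ) : ℤ)).toLocal (Sum.inr w)) 1, x ≠ 0)
    (S : Finset (HeightOneSpectrum (𝓞 K))) (hwS : w ∉ S)
    (H : ∀ v : Place K, AddSubgroup (galoisCohomology ((W.torsionGaloisModule ((p ^ k : ℕ) : ℤ)).toLocal v) 1))
    (hH : ∀ v ∈ S, Nat.card (H (Sum.inr v)) * Nat.card (H (Sum.inr v)) =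
      Nat.card (galoisCohomology ((W.torsionGaloisModule ((p ^ k : ℕ) : ℤ)).toLocal (Sum.inr v)) 1)) :
    ∃ c : galoisCohomology (W.torsionGaloisModule ((p ^ k : ℕ) : ℤ)) 1, c ≠ 0 ∧
      (∀ v : Place K, v ∉ S.map Function.Embedding.inr → v ≠ Sum.inr w →
        galoisCohomology.localization (W.torsionGaloisModule ((p ^ k : ℕ) : ℤ)) v 1 c ∈
          W.kummerSelmerStructure ((p ^ k : ℕ) : ℤ) v) ∧
      (∀ v ∈ S, galoisCohomology.localization (W.torsionGaloisModule ((p ^ k : ℕ) : ℤ)) (Sum.inr v) 1 c ∈ H (Sum.inr v)) := by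
  haveI := finite_galoisCohomology_toLocal_inr W (p ^ k) w
  have hw' : 1 < Nat.card (galoisCohomology ((W.torsionGaloisModule ((p ^ k : ℕ) : ℤ)).toLocal (Sum.inr w)) 1) := by
    obtain ⟨x, hx⟩ := hw
    exact Finite.one_lt_card_iff_nontrivial.mpr ⟨⟨x, 0, hx⟩⟩
  have hH' : ∀ v ∈ S, Nat.card (H (Sum.inr v)) ^ 2 =
      Nat.card (galoisCohomology ((W.torsionGaloisModule ((p ^ k : ℕ) : ℤ)).toLocal (Sum.inr v)) 1) := by
    intro v hv; rw [sq]; exact hH v hv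
  obtain ⟨c, hc0, hcH, hcfin, hcinf⟩ := exists_ne_zero_selmerLocalKer_real W p k hk S w hwS hw'
    (fun v ↦ H (Sum.inr v)) hH'
  refine ⟨c, hc0, fun v hvS hvw ↦ ?_, hcH⟩
  have hcv : c ∈ W.selmerLocalKer (Place.Completion v) ((p ^ k : ℕ) : ℤ) := by
    rcases v with w' | u
    · exact hcinf w'
    · refine hcfin u (fun hu ↦ hvS ?_) (fun huw ↦ hvw (by rw [huw]))
      exact Finset.mem_map.mpr ⟨u, hu, rfl⟩
  have h := (W.comap_localization_kummerSelmerStructure ((p ^ k : ℕ) : ℤ) v).symm ▸ hcv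
  exact h

end Kummer

end Summit.BirchSwinnertonDyer.BirchSwinnertonDyer.Theorems.GenusExact.AuxiliaryClass

end
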